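import Literature.RepresentationTheory.HeisenbergGroup.SchrodingerPiOperators
import Literature.RepresentationTheory.HeisenbergGroup.SchrodingerLeraySectionGram
import Literature.NumberTheory.Automorphic.LocalPiSchwartzBruhatPlancherel
import HarnessLib

/-!
# Every element of `Sp(F^ι ⊕ F^ι)` has an `L²`-ISOMETRIC implementer on the Schrödinger model `𝒮(F^ι)`

Topic `RepresentationTheory/HeisenbergGroup`; namespace `Literature.RepresentationTheory.HeisenbergGroup`. KERNEL
ONLY: theorems; no definition, no named fact, no `sorry`.  Sequel of `SchrodingerPiOperators.lean` (the operators
`r(n(c))`, `r(m(a))`, `r(w)` on `𝒮(F^ι)` implementing the unipotent, Levi and Weyl elements) and of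
`Automorphic/LocalPiSchwartzBruhatPlancherel.lean` (Plancherel for the Fourier transform of `𝒮(F^ι)`).

[Weil1964, Chap. I n° 13]: the operators `t₀(f)` (multiplication by a character of second degree), `d₀(α)`
(`Φ ↦ |α|^{1/2} Φ ∘ α`) and `d₀'(γ)` (Fourier transform for the self-dual measure) are UNITARY on `L²(X)` and preserve
`𝒮(X)`; they implement generators of the pseudo-symplectic group.  Here, for a non-archimedean local field `F` with `2`
invertible, a finite `ι`, a continuous non-trivial `ψ` and the product `μ^ι` of a Haar measure `μ` on `F`
(`‖Φ‖² = ∫ |Φ|² dμ^ι`, `SchwartzBruhat.l2NormSq`):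

* §1 `l2NormSq_unipOpPi` (unimodular multiplier), `l2NormSq_leviOpPi` (the module of `a` is `|det a|`, tree
  `map_linearMap_pi_eq_smul`, against the normalisation `|det a|^{-1/2}`), `l2NormSq_fourierOpPi`
  (`= c ‖Φ‖²`, Plancherel, `c = μ^ι(𝒪^ι) μ^ι((𝔭^m)^ι)`) and the RENORMALISED Fourier operator `c^{-1/2} r(w)`, an
  isometry implementing the Weyl element;
* §2 **`exists_isometric_implementer_pi`** — every `g ∈ Sp(F^ι ⊕ F^ι)` (standard duality) admits an implementer `M`
  on `𝒮(F^ι)` with `‖M Φ‖² = ‖Φ‖²` for all `Φ`: the elements admitting an isometric implementer form a subgroup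
  containing the generators (tree `symplecticGroup_pi_eq_top_of_mem`, [MoeglinVignerasWaldspurger1987, Chap. 2 II.5]);
* §3 **`exists_isometric_implementer_gram`** — the same for the Schrödinger model of a Gram duality `⟨x, T y⟩`,
  `det T` a unit (transport along `(x, y) ↦ (x, T y)`, tree `implements_iff_implements_symplecticConj`) — the model
  `localSchrodinger` of the Hodge/COR-CM cell's local splitting data.

Use (GR-1 Track 2): discharges hypothesis `hE` of `GelbartRogawski1991/LocalSplittingIsometricCriterion.lean`: the
Leray–Rao section and the local Weil representation `β⁻¹ · r ∘ ι` of the tree are `L²`-isometric.  Nothing is cited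
as a hypothesis.

## References
* [Weil1964] A. Weil, Acta Math. 111 (1964), Chap. I n° 13 (unitarity of `t₀`, `d₀`, `d₀'`), n° 11.
* [MoeglinVignerasWaldspurger1987] C. Mœglin, M.-F. Vignéras, J.-L. Waldspurger, LNM 1291 (1987), Chap. 2 II.1, II.5–II.6.
* [Rangarao1993] R. Ranga Rao, Pacific J. Math. 157 (1993), Lemma 3.2, (3.8)–(3.9).
-/

set_option autoImplicit false

noncomputable section

namespace Literature.RepresentationTheory.HeisenbergGroup

open _root_.MeasureTheory _root_.MeasureTheory.Measure
open scoped ENNReal NNReal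
open Literature.NumberTheory.Automorphic
open Literature.NumberTheory.GaloisRepresentations.IsNonarchimedeanLocalField
open Literature.NumberTheory.Weil1964

section Pi

variable {F : Type*} [Field F] [ValuativeRel F] [TopologicalSpace F] [IsNonarchimedeanLocalField F]
  {ι : Type*} [Fintype ι] [DecidableEq ι] [Invertible (2 : F)]
  {ψ : AddChar F Circle} (hl : IsLocallyConstant (⇑ψ : F → Circle))
  (hb : ∀ y : ι → F, Continuous fun u : ι → F => dotProductBilin F F u y)
  [MeasurableSpace F] [BorelSpace F] (μ : Measure F) [μ.IsAddHaarMeasure] {m : ℤ}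

/-! ## §1 The generators' operators are `L²`-isometric -/

omit [DecidableEq ι] [BorelSpace F] [μ.IsAddHaarMeasure] in
/-- **`r(n(c))` is `L²`-isometric**: it multiplies by the unimodular `ψ(−½⟨u, cu⟩)`. [cite: Weil1964, Chap. I n° 13] -/
theorem l2NormSq_unipOpPi (c : (ι → F) →ₗ[F] (ι → F)) (Φ : SchwartzBruhat (ι → F)) :
    SchwartzBruhat.l2NormSq (Measure.pi fun _ : ι => μ) (unipOpPi hl c Φ) =
      SchwartzBruhat.l2NormSq (Measure.pi fun _ : ι => μ) Φ := by
  rw [SchwartzBruhat.l2NormSq_def, SchwartzBruhat.l2NormSq_def]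
  refine lintegral_congr fun u => ?_
  rw [coe_unipOpPi_apply, enorm_mul]
  have : ‖((ψ (-halfForm c u) : Circle) : ℂ)‖ₑ = 1 := by
    rw [← ofReal_norm, Circle.norm_coe, ENNReal.ofReal_one]
  rw [this, one_mul]

omit [Fintype ι] [DecidableEq ι] [Invertible (2 : F)] [MeasurableSpace F] [BorelSpace F] in
/-- the normalising factor against the module: `‖(|det a|^{1/2})⁻¹‖² · |det a| = 1` in `ℝ≥0∞`.
[cite: Rangarao1993, Lemma 3.2 (1), p. 351] -/
private theorem enorm_inv_modSqrt_sq_mul (a : (ι → F) ≃ₗ[F] (ι → F)) :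
    ‖((modSqrt a : ℂ))⁻¹‖ₑ ^ 2 *
        ((normAbs F (LinearMap.det (a : (ι → F) →ₗ[F] (ι → F))) : ℝ≥0) : ℝ≥0∞) = 1 := by
  set n : ℝ≥0 := normAbs F (LinearMap.det (a : (ι → F) →ₗ[F] (ι → F))) with hn
  have hn0 : n ≠ 0 := by
    have hdet : LinearMap.det (a : (ι → F) →ₗ[F] (ι → F)) ≠ 0 := by
      simpa using (LinearEquiv.isUnit_det' a).ne_zero
    exact (map_ne_zero (normAbs F)).2 hdet
  have hms : 0 < modSqrt a := modSqrt_pos a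
  -- `‖(modSqrt a)⁻¹‖ₑ ^ 2 = n⁻¹`
  have h1 : ‖((modSqrt a : ℂ))⁻¹‖ₑ ^ 2 = ((n⁻¹ : ℝ≥0) : ℝ≥0∞) := by
    rw [← ofReal_norm, norm_inv, Complex.norm_real, Real.norm_of_nonneg hms.le, ← ENNReal.ofReal_pow (by positivity),
      inv_pow, modSqrt_sq, ← NNReal.coe_inv, ENNReal.ofReal_coe_nnreal]
  rw [h1, ← ENNReal.coe_mul, inv_mul_cancel₀ hn0, ENNReal.coe_one]

omit [DecidableEq ι] [Invertible (2 : F)] in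
/-- **`r(m(a))` is `L²`-isometric**: `∫ |det a|⁻¹ |Φ(a⁻¹u)|² dμ^ι(u) = ∫ |Φ|² dμ^ι` — the image of `μ^ι` under `a⁻¹`
is `|det a| · μ^ι` (tree `map_linearMap_pi_eq_smul`). [cite: Weil1964, Chap. I n° 13] [cite: Rangarao1993, Lemma 3.2 (1)] -/
theorem l2NormSq_leviOpPi (a : (ι → F) ≃ₗ[F] (ι → F)) (Φ : SchwartzBruhat (ι → F)) :
    SchwartzBruhat.l2NormSq (Measure.pi fun _ : ι => μ) (leviOpPi a Φ) =
      SchwartzBruhat.l2NormSq (Measure.pi fun _ : ι => μ) Φ := by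
  have hdet : LinearMap.det (a.symm : (ι → F) →ₗ[F] (ι → F)) ≠ 0 := by
    simpa using (LinearEquiv.isUnit_det' a.symm).ne_zero
  rw [SchwartzBruhat.l2NormSq_def, SchwartzBruhat.l2NormSq_def]
  have hpt : (fun u => ‖((leviOpPi a Φ : SchwartzBruhat (ι → F)) : (ι → F) → ℂ) u‖ₑ ^ 2) =
      fun u => ‖((modSqrt a : ℂ))⁻¹‖ₑ ^ 2 * ‖(Φ : (ι → F) → ℂ) (a.symm u)‖ₑ ^ 2 := by
    funext u
    rw [coe_leviOpPi_apply, enorm_mul, mul_pow]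
  rw [hpt, lintegral_const_mul' _ _ (ENNReal.pow_ne_top enorm_ne_top)]
  -- change of variables along `a⁻¹`
  have hcv : ∫⁻ u, ‖(Φ : (ι → F) → ℂ) (a.symm u)‖ₑ ^ 2 ∂(Measure.pi fun _ : ι => μ) =
      ((normAbs F (LinearMap.det (a : (ι → F) →ₗ[F] (ι → F))) : ℝ≥0) : ℝ≥0∞) *
        ∫⁻ u, ‖(Φ : (ι → F) → ℂ) u‖ₑ ^ 2 ∂(Measure.pi fun _ : ι => μ) := by
    have h1 := lintegral_map_equiv (μ := Measure.pi fun _ : ι => μ) (fun u => ‖(Φ : (ι → F) → ℂ) u‖ₑ ^ 2)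
      (linearEquivMeasurableEquiv a.symm)
    rw [coe_linearEquivMeasurableEquiv] at h1
    rw [← h1, show ((a.symm : (ι → F) ≃ₗ[F] (ι → F)) : (ι → F) → ι → F) =
        ((a.symm : (ι → F) →ₗ[F] (ι → F)) : (ι → F) → ι → F) from rfl,
      map_linearMap_pi_eq_smul μ hdet, lintegral_smul_measure, LinearEquiv.det_coe_symm, inv_inv, smul_eq_mul]
  rw [hcv, ← mul_assoc, enorm_inv_modSqrt_sq_mul (F := F) a, one_mul]

/- For the Fourier operator the product measure `μ^ι` must be seen as a Haar measure on `F^ι`, which needs the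
(true, `secondCountableTopology_localField`) instance `SecondCountableTopology F` IN SCOPE; it is taken as an
instance argument below and supplied by `haveI` at the call sites. -/
variable [SecondCountableTopology F]

omit [DecidableEq ι] [Invertible (2 : F)] in
/-- **Plancherel for `r(w)`**: `‖Φ̂‖² = c ‖Φ‖²` with `c = μ^ι(𝒪^ι) μ^ι((𝔭^m)^ι)` (`= 1` for the self-dual measure).
[cite: Weil1964, Chap. I n° 13] -/
theorem l2NormSq_fourierOpPi (hψ : ψ.IsContinuousNontrivial) (hm : ψ.HasConductorExp m) (Φ : SchwartzBruhat (ι → F)) :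
    SchwartzBruhat.l2NormSq (Measure.pi fun _ : ι => μ) (fourierOpPi μ hψ hm Φ) =
      ENNReal.ofReal (piSelfDualConst F ι (Measure.pi fun _ : ι => μ) m) *
        SchwartzBruhat.l2NormSq (Measure.pi fun _ : ι => μ) Φ := by
  rw [SchwartzBruhat.l2NormSq_def, SchwartzBruhat.l2NormSq_def, coe_fourierOpPi]
  exact lintegral_enorm_sq_piFourierSB (Measure.pi fun _ : ι => μ) hψ hm Φ.2

omit [DecidableEq ι] [Invertible (2 : F)] in
/-- **the renormalised Fourier operator `c^{−1/2} · r(w)` is `L²`-isometric.** [cite: Weil1964, Chap. I n° 13] -/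
theorem l2NormSq_scalarOp_fourierOpPi (hψ : ψ.IsContinuousNontrivial) (hm : ψ.HasConductorExp m)
    (Φ : SchwartzBruhat (ι → F)) :
    SchwartzBruhat.l2NormSq (Measure.pi fun _ : ι => μ)
        ((scalarOp (S := SchwartzBruhat (ι → F))
            (Units.mk0 ((Real.sqrt (piSelfDualConst F ι (Measure.pi fun _ : ι => μ) m) : ℝ) : ℂ)
              (Complex.ofReal_ne_zero.2 (Real.sqrt_pos.2 (piSelfDualConst_pos _)).ne'))⁻¹ *
          fourierOpPi μ hψ hm : SchwartzBruhat (ι → F) ≃ₗ[ℂ] SchwartzBruhat (ι → F)) Φ) =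
      SchwartzBruhat.l2NormSq (Measure.pi fun _ : ι => μ) Φ := by
  set c : ℝ := piSelfDualConst F ι (Measure.pi fun _ : ι => μ) m with hc
  have hcpos : 0 < c := piSelfDualConst_pos _
  rw [LinearEquiv.mul_apply, scalarOp_apply, SchwartzBruhat.l2NormSq_smul, l2NormSq_fourierOpPi μ hψ hm,
    ← mul_assoc]
  have h1 : ‖(((Units.mk0 ((Real.sqrt c : ℝ) : ℂ)
      (Complex.ofReal_ne_zero.2 (Real.sqrt_pos.2 hcpos).ne'))⁻¹ : ℂˣ) : ℂ)‖ₑ ^ 2 * ENNReal.ofReal c = 1 := by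
    rw [Units.val_inv_eq_inv_val, Units.val_mk0, ← ofReal_norm, norm_inv, Complex.norm_real,
      Real.norm_of_nonneg (Real.sqrt_nonneg _), ← ENNReal.ofReal_pow (by positivity), inv_pow,
      Real.sq_sqrt hcpos.le, ← ENNReal.ofReal_mul (by positivity), inv_mul_cancel₀ hcpos.ne', ENNReal.ofReal_one]
  rw [h1, one_mul]

/-! ## §2 Every symplectic element has an `L²`-isometric implementer -/

/-- **Every `g ∈ Sp(F^ι ⊕ F^ι)` admits an `L²(μ^ι)`-isometric implementer on `𝒮(F^ι)`** (Schrödinger model of the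
standard duality): the elements admitting one form a subgroup (isometric implementers compose and invert inside
`S̃p_ψ`), which contains `m(a)` (by `r(m(a))`), `n(c)` (by `r(n(c))`) and the Weyl element (by `c^{−1/2} r(w)`), hence is
everything. [cite: Weil1964, Chap. I n° 13] [cite: MoeglinVignerasWaldspurger1987, Chap. 2 II.5–II.6] -/
theorem exists_isometric_implementer_pi (hψ : ψ.IsContinuousNontrivial) (hm : ψ.HasConductorExp m)
    (g : symplecticGroup (polar (dotProductBilin F F (m := ι)))) :
    ∃ M : SchwartzBruhat (ι → F) ≃ₗ[ℂ] SchwartzBruhat (ι → F),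
      Implements (schrodingerSB (dotProductBilin F F) ψ hl hb) (ofSymplectic _ g) M ∧
        ∀ Φ, SchwartzBruhat.l2NormSq (Measure.pi fun _ : ι => μ) (M Φ) =
          SchwartzBruhat.l2NormSq (Measure.pi fun _ : ι => μ) Φ := by
  set ρ := schrodingerSB (dotProductBilin F F (m := ι)) ψ hl hb with hρ
  set ν : Measure (ι → F) := Measure.pi fun _ : ι => μ with hν
  -- the subgroup of isometrically implemented elements
  let L : Subgroup (symplecticGroup (polar (dotProductBilin F F (m := ι)))) :=
    { carrier := {g | ∃ M : SchwartzBruhat (ι → F) ≃ₗ[ℂ] SchwartzBruhat (ι → F),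
        (g, M) ∈ MpPsi ρ ∧ ∀ Φ, SchwartzBruhat.l2NormSq ν (M Φ) = SchwartzBruhat.l2NormSq ν Φ}
      mul_mem' := by
        rintro g g' ⟨M, hM, hMi⟩ ⟨M', hM', hM'i⟩
        refine ⟨M * M', ?_, fun Φ => by rw [LinearEquiv.mul_apply, hMi, hM'i]⟩
        have h := (MpPsi ρ).mul_mem hM hM'
        rwa [Prod.mk_mul_mk] at h
      one_mem' := ⟨1, (MpPsi ρ).one_mem, fun Φ => rfl⟩
      inv_mem' := by
        rintro g ⟨M, hM, hMi⟩
        refine ⟨M⁻¹, ?_, fun Φ => ?_⟩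
        · have h := (MpPsi ρ).inv_mem hM
          rwa [Prod.inv_mk] at h
        · have h := hMi (M⁻¹ Φ)
          rw [← LinearEquiv.mul_apply, mul_inv_cancel] at h
          exact h.symm }
  have htop : L = ⊤ := by
    refine symplecticGroup_pi_eq_top_of_mem (fun a d had => ?_) (fun c hc => ?_) ?_
    · -- Levi: `|det a|^{-1/2} Φ(a⁻¹ ·)`
      refine ⟨leviOpPi a, ?_, l2NormSq_leviOpPi μ a⟩
      have h₁ := levi_mem_MpPsi (dotProductBilin F F) ψ hl hb a d had a.toLinearMap.continuous_on_pi
        a.symm.toLinearMap.continuous_on_pi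
      have h₂ := one_scalarOp_mem_MpPsi ρ (modSqrtUnit a)⁻¹
      have e : (leviSp (dotProductBilin F F (m := ι)) a d had, leviOpPi a)
          = ((1 : symplecticGroup (polar (dotProductBilin F F (m := ι)))), scalarOp (modSqrtUnit a)⁻¹) *
            (leviSp (dotProductBilin F F (m := ι)) a d had,
              leviEquivSB a a.toLinearMap.continuous_on_pi a.symm.toLinearMap.continuous_on_pi) := by
        rw [Prod.mk_mul_mk, one_mul]; rfl
      rw [e]
      exact (MpPsi ρ).mul_mem h₂ h₁
    · -- unipotent: a unimodular multiplier
      exact ⟨unipOpPi hl c, unipotent_unipOpPi_mem_MpPsi hl hb c hc, l2NormSq_unipOpPi hl μ c⟩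
    · -- Weyl: the renormalised Fourier transform
      refine ⟨scalarOp (S := SchwartzBruhat (ι → F)) (Units.mk0 ((Real.sqrt (piSelfDualConst F ι ν m) : ℝ) : ℂ)
            (Complex.ofReal_ne_zero.2 (Real.sqrt_pos.2 (piSelfDualConst_pos _)).ne'))⁻¹ * fourierOpPi μ hψ hm,
          ?_, l2NormSq_scalarOp_fourierOpPi μ hψ hm⟩
      have h₁ := weyl_fourierOpPi_mem_MpPsi hl hb μ hψ hm
      have h₂ := one_scalarOp_mem_MpPsi ρ (S := SchwartzBruhat (ι → F))
        (Units.mk0 ((Real.sqrt (piSelfDualConst F ι ν m) : ℝ) : ℂ)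
            (Complex.ofReal_ne_zero.2 (Real.sqrt_pos.2 (piSelfDualConst_pos _)).ne'))⁻¹
      have h := (MpPsi ρ).mul_mem h₂ h₁
      rwa [Prod.mk_mul_mk, one_mul] at h
  have hg : g ∈ L := by rw [htop]; exact Subgroup.mem_top g
  obtain ⟨M, hM, hMi⟩ := hg
  exact ⟨M, (mem_MpPsi ρ _).1 hM, hMi⟩

end Pi

/-! ## §3 The Schrödinger model of a Gram duality `⟨x, T y⟩` -/

section Gram

variable {F : Type*} [Field F] [ValuativeRel F] [TopologicalSpace F] [IsNonarchimedeanLocalField F]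
  {ι : Type*} [Fintype ι] [DecidableEq ι] [Invertible (2 : F)] (T : Matrix ι ι F) (hT : IsUnit T.det)
  {ψ : AddChar F Circle} (hl : IsLocallyConstant (⇑ψ : F → Circle))
  (hbT : ∀ y : ι → F, Continuous fun u : ι → F => Matrix.toLinearMap₂' F T u y)
  [MeasurableSpace F] [BorelSpace F] (μ : Measure F) [μ.IsAddHaarMeasure] {m : ℤ} [SecondCountableTopology F]

include hT in
/-- **Every `g ∈ Sp(W, A_T)` admits an `L²(μ^ι)`-isometric implementer on `𝒮(F^ι)` for the Schrödinger model `ρ_T`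
of the Gram duality `⟨x, T y⟩`** (`det T` a unit): transport of `exists_isometric_implementer_pi` along
`e_T : (x, y) ↦ (x, T y)` — `ρ_T = ρ_1 ∘ e_T` acts on the SAME space, so the operators are unchanged.
[cite: Weil1964, Chap. I n° 13] [cite: MoeglinVignerasWaldspurger1987, Chap. 2 II.1 (A)] -/
theorem exists_isometric_implementer_gram (hψ : ψ.IsContinuousNontrivial) (hm : ψ.HasConductorExp m)
    (g : symplecticGroup (polar (Matrix.toLinearMap₂' F T))) :
    ∃ M : SchwartzBruhat (ι → F) ≃ₗ[ℂ] SchwartzBruhat (ι → F),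
      Implements (schrodingerSB (Matrix.toLinearMap₂' F T) ψ hl hbT) (ofSymplectic _ g) M ∧
        ∀ Φ, SchwartzBruhat.l2NormSq (Measure.pi fun _ : ι => μ) (M Φ) =
          SchwartzBruhat.l2NormSq (Measure.pi fun _ : ι => μ) Φ := by
  obtain ⟨M, hM, hMi⟩ := exists_isometric_implementer_pi hl continuous_dotProductBilin_left μ hψ hm
    (symplecticConj (gramProd T hT) (polar_dotProductBilin_gramProd T hT) g)
  exact ⟨M, (implements_iff_implements_symplecticConj (gramProd T hT) (polar_dotProductBilin_gramProd T hT)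
    (schrodingerSB_gram_eq T hT hl continuous_dotProductBilin_left hbT) g M).2 hM, hMi⟩

end Gram

end Literature.RepresentationTheory.HeisenbergGroup

end
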